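import Summits.AtomisticToContinuum.Crystallization.Theses.GappedShellCensus
import Literature.Geometry.DiscreteGeometry.KissingFanTriangleSets
import Literature.Geometry.DiscreteGeometry.DihedralAngleFraction
import Summits.AtomisticToContinuum.Crystallization.Theorems.GappedShellCensusShellTrichotomyStubOriginInterior
import Summits.AtomisticToContinuum.Crystallization.Theorems.GappedShellCensusShellTrichotomyStubTCornerMax
import Summits.AtomisticToContinuum.Crystallization.Theorems.GappedShellCensusShellTrichotomyStubHCornerMax

/-!
# Crux `GappedShellCensus.ShellTrichotomy` (stmt-AtomisticToContinuum-18070), line `Sketch` —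
# stub `stub_fanAngles`

**Dictionary, angle part.**  For an all-degree-4 gapped twelve-shell `t : Fin 12 → ℝ³` (norms in
`[0.98, 1.02]`, pairwise distances `≥ 0.98` and either `≤ 1.02` — a bond — or `≥ 1.26`, every
point with exactly four bonded shell neighbours) let `u k = t k / ‖t k‖`, `X = {u k}`, and pull
the fan triangles `fanTriSets X` of the hull of `X` back to label triples `tri`, with angles
`ang S k = triAngleAt X (u '' S) (u k)`.  Then:

* `ang ≥ 0`, `ang S k = 0` for `k ∉ S` (tree lemmas `triAngleAt_nonneg`,
  `triAngleAt_eq_zero_of_not_mem`, injectivity of `u`);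
* the node equation `Σ_{S ∈ tri} ang S k = 2π` (tree `sum_triAngleAt`; its hypothesis
  `0 ∈ interior (conv X)` is the landed `stub_originInterior`; `S ↦ u '' S` is a bijection
  `tri → fanTriSets X`);
* the coupled corner bounds: on a bonded triangle `ang ≤ arccos (1/4)` (landed `stub_tCornerMax`),
  on `{v, a, x}` with bonds `va`, `ax` and `vx` far `ang {v,a,x} v ≤ arccos (807/2000)` (landed
  `stub_hCornerMax`), and on `{v, d, a}` with the quad `v d x a` bonded around and both diagonals
  far `ang {v,d,a} v ≤ 2 arccos (807/2000)` (triangle inequality for angles,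
  `InnerProductGeometry.angle_le_angle_add_angle`, and `stub_hCornerMax` twice).

The landed corner stubs are stated for the original points `t`; the fan angle
`∠(perpTo (u v) (u a), perpTo (u v) (u b))` (`triAngleAt_eq_angle`) agrees with
`∠(perpTo (t v) (t a), perpTo (t v) (t b))` because `perpTo` is `0`-homogeneous in its first
argument, linear in its second, and `angle` is invariant under positive scalings
(`angle_perpTo_smul`).
-/

noncomputable section

namespace Summit.AtomisticToContinuum.Crystallization.Theorems

open scoped RealInnerProductSpace
open Literature.Geometry.DiscreteGeometry InnerProductGeometry

local notation "E3" => EuclideanSpace ℝ (Fin 3)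

/-! ### Scaling invariance of the dihedral angle -/

/-- `perpTo` is `0`-homogeneous in its first argument. -/
private theorem perpTo_smul_left (p q : E3) {c : ℝ} (hc : c ≠ 0) :
    perpTo (c • p) q = perpTo p q := by
  rw [perpTo_def, perpTo_def, real_inner_smul_left, real_inner_smul_left, real_inner_smul_right,
    smul_smul]
  rcases eq_or_ne p 0 with rfl | hp
  · simp
  · have hpp : ⟪p, p⟫ ≠ 0 := fun h => hp (inner_self_eq_zero.1 h)
    congr 2
    field_simp

/-- The dihedral angle about the spoke `0p` between `q` and `r` is invariant under rescaling the
three points by nonzero resp. positive factors. -/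
private theorem angle_perpTo_smul (p q r : E3) {α β γ : ℝ} (hα : α ≠ 0) (hβ : 0 < β) (hγ : 0 < γ) :
    angle (perpTo (α • p) (β • q)) (perpTo (α • p) (γ • r)) = angle (perpTo p q) (perpTo p r) := by
  rw [perpTo_smul_left p _ hα, perpTo_smul_left p _ hα, perpTo_smul_right, perpTo_smul_right,
    angle_smul_left_of_pos _ _ hβ, angle_smul_right_of_pos _ _ hγ]

/-! ### Three-element label sets -/

/-- A three-element set `{v, a, b}` has `v ≠ a` and `v ≠ b`. -/
private theorem ne_of_card_triple {α : Type*} [DecidableEq α] {v a b : α}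
    (h : ({v, a, b} : Finset α).card = 3) : v ≠ a ∧ v ≠ b := by
  constructor
  · rintro rfl
    rw [Finset.insert_idem] at h
    have := Finset.card_le_two (a := v) (b := b)
    omega
  · rintro rfl
    rw [Finset.insert_eq_of_mem (Finset.mem_insert_of_mem (Finset.mem_singleton_self v))] at h
    have := Finset.card_le_two (a := a) (b := v)
    omega

/-- A three-element set containing `v` is `{v, a, b}` with `v, a, b` distinct. -/
private theorem exists_eq_triple {α : Type*} [DecidableEq α] {S : Finset α} (hS : S.card = 3)
    {v : α} (hv : v ∈ S) : ∃ a b, v ≠ a ∧ v ≠ b ∧ a ≠ b ∧ S = {v, a, b} := by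
  obtain ⟨x, y, z, hxy, hxz, hyz, rfl⟩ := Finset.card_eq_three.1 hS
  simp only [Finset.mem_insert, Finset.mem_singleton] at hv
  rcases hv with rfl | rfl | rfl
  · exact ⟨y, z, hxy, hxz, hyz, rfl⟩
  · exact ⟨x, z, hxy.symm, hyz, hxz, Finset.insert_comm _ _ _⟩
  · exact ⟨x, y, hxz.symm, hyz.symm, hxy, by rw [Finset.pair_comm y, Finset.insert_comm]⟩

/-! ### The labelled fan: triangles and angles pulled back along `u` -/

/-- The fan triangles of `X = u '' univ` are exactly the images of the label triples whose image
is a fan triangle. -/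
private theorem fanTriSets_eq_image {u : Fin 12 → E3} (hX1 : ∀ y ∈ Finset.univ.image u, ‖y‖ = 1) :
    fanTriSets (Finset.univ.image u) =
      (Finset.univ.powerset.filter fun S : Finset (Fin 12) =>
        S.image u ∈ fanTriSets (Finset.univ.image u)).image fun S => S.image u := by
  ext T
  simp only [Finset.mem_image, Finset.mem_filter, Finset.mem_powerset, Finset.subset_univ,
    true_and]
  constructor
  · intro hT
    have himg : (Finset.univ.filter fun k => u k ∈ T).image u = T := by
      ext y
      simp only [Finset.mem_image, Finset.mem_filter, Finset.mem_univ, true_and]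
      constructor
      · rintro ⟨k, hk, rfl⟩
        exact hk
      · intro hy
        obtain ⟨k, -, rfl⟩ := Finset.mem_image.1 (subset_of_mem_fanTriSets hX1 hT hy)
        exact ⟨k, hy, rfl⟩
    exact ⟨_, by rw [himg]; exact hT, himg⟩
  · rintro ⟨S, hS, rfl⟩
    exact hS

/-- **Node equation on the labelled fan**: the angles at the label `v` of the label triples sum
to `2π`. -/
private theorem sum_triAngleAt_labels {u : Fin 12 → E3} (hX1 : ∀ y ∈ Finset.univ.image u, ‖y‖ = 1)
    (huinj : Function.Injective u)
    (h0 : (0 : E3) ∈ interior (convexHull ℝ ((Finset.univ.image u : Finset E3) : Set E3)))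
    (v : Fin 12) :
    ∑ S ∈ Finset.univ.powerset.filter (fun S : Finset (Fin 12) =>
        S.image u ∈ fanTriSets (Finset.univ.image u)),
      triAngleAt (Finset.univ.image u) (S.image u) (u v) = 2 * Real.pi := by
  have hinj : Set.InjOn (fun S : Finset (Fin 12) => S.image u)
      ↑(Finset.univ.powerset.filter fun S : Finset (Fin 12) =>
        S.image u ∈ fanTriSets (Finset.univ.image u)) :=
    (Finset.image_injective huinj).injOn
  have h := sum_triAngleAt hX1 h0 (Finset.mem_image_of_mem u (Finset.mem_univ v))
  rwa [fanTriSets_eq_image hX1, Finset.sum_image hinj] at h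

/-- **The angle of a labelled fan triangle `{v, a, b}` at `v` is the dihedral angle of the
ORIGINAL points** `∠(perpTo (t v) (t a), perpTo (t v) (t b))`. -/
private theorem triAngleAt_labels_eq {t u : Fin 12 → E3} (hu : ∀ k, u k = ‖t k‖⁻¹ • t k)
    (hr : ∀ k, 0 < ‖t k‖) (hX1 : ∀ y ∈ Finset.univ.image u, ‖y‖ = 1)
    (huinj : Function.Injective u) {v a b : Fin 12}
    (hT : ({v, a, b} : Finset (Fin 12)).image u ∈ fanTriSets (Finset.univ.image u))
    (hva : v ≠ a) (hvb : v ≠ b) :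
    triAngleAt (Finset.univ.image u) (({v, a, b} : Finset (Fin 12)).image u) (u v) =
      angle (perpTo (t v) (t a)) (perpTo (t v) (t b)) := by
  have himg : ({v, a, b} : Finset (Fin 12)).image u = {u v, u a, u b} := by
    rw [Finset.image_insert, Finset.image_insert, Finset.image_singleton]
  rw [himg] at hT ⊢
  rw [triAngleAt_eq_angle hX1 hT (huinj.ne hva) (huinj.ne hvb), hu v, hu a, hu b]
  exact angle_perpTo_smul (t v) (t a) (t b) (inv_pos.2 (hr v)).ne' (inv_pos.2 (hr a))
    (inv_pos.2 (hr b))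

/-! ### The stub -/

/-- **Dictionary, angle part (node equation and coupled corner bounds on the labelled fan).** The
angle `triAngleAt` of a fan triangle at a label: nonnegative, zero off the triangle, summing to `2π`
at every label (`sum_triAngleAt`, with `0 ∈ interior (conv X)` from `stub_originInterior`),
`≤ arccos (1/4)` on bonded triangles (`stub_tCornerMax`), `≤ arccos (807/2000)` at `v` on a
triangle `{v, a, x}` with `va`, `ax` bonds and `vx` far (`stub_hCornerMax`), and
`≤ 2·arccos (807/2000)` at `v` on `{v, d, a}` when the quad `v d x a` is split by its other
diagonal (`InnerProductGeometry.angle_le_angle_add_angle` + `stub_hCornerMax` twice).  The corner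
stubs speak about the original points; the fan angles about the normalised ones — they agree by
`angle_perpTo_smul`. -/
theorem stub_fanAngles_let (t : Fin 12 → EuclideanSpace ℝ (Fin 3)) (hinj : Function.Injective t)
    (hn : ∀ k, 1 - 1 / 50 ≤ ‖t k‖ ∧ ‖t k‖ ≤ 1 + 1 / 50)
    (hd : ∀ k l, k ≠ l → 1 - 1 / 50 ≤ dist (t k) (t l) ∧ (dist (t k) (t l) ≤ 1 + 1 / 50 ∨ 63 / 50 ≤ dist (t k) (t l)))
    (h4 : ∀ k, (Finset.univ.filter fun l => l ≠ k ∧ dist (t k) (t l) ≤ 1 + 1 / 50).card = 4) :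
    let u : Fin 12 → EuclideanSpace ℝ (Fin 3) := fun k => ‖t k‖⁻¹ • t k
    let X : Finset (EuclideanSpace ℝ (Fin 3)) := Finset.univ.image u
    let tri : Finset (Finset (Fin 12)) := Finset.univ.powerset.filter fun S => S.image u ∈ fanTriSets X
    let ang : Finset (Fin 12) → Fin 12 → ℝ := fun S k => triAngleAt X (S.image u) (u k)
    (∀ S v, 0 ≤ ang S v) ∧ (∀ S v, v ∉ S → ang S v = 0) ∧ (∀ v, ∑ S ∈ tri, ang S v = 2 * Real.pi) ∧
      (∀ S ∈ tri, (∀ v ∈ S, ∀ w ∈ S, v ≠ w → dist (t v) (t w) ≤ 1 + 1 / 50) → ∀ v ∈ S, ang S v ≤ Real.arccos (1 / 4)) ∧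
      (∀ v a x, ({v, a, x} : Finset (Fin 12)) ∈ tri → dist (t v) (t a) ≤ 1 + 1 / 50 → dist (t a) (t x) ≤ 1 + 1 / 50 →
        63 / 50 ≤ dist (t v) (t x) → ang {v, a, x} v ≤ Real.arccos (807 / 2000)) ∧
      (∀ v d a x, ({v, d, a} : Finset (Fin 12)) ∈ tri → dist (t v) (t d) ≤ 1 + 1 / 50 → dist (t v) (t a) ≤ 1 + 1 / 50 →
        63 / 50 ≤ dist (t d) (t a) → dist (t d) (t x) ≤ 1 + 1 / 50 → dist (t x) (t a) ≤ 1 + 1 / 50 →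
        63 / 50 ≤ dist (t v) (t x) → ang {v, d, a} v ≤ 2 * Real.arccos (807 / 2000)) := by
  intro u X tri ang
  -- basic facts about the normalised shell
  have hu : ∀ k, u k = ‖t k‖⁻¹ • t k := fun k => rfl
  have hr : ∀ k, 0 < ‖t k‖ := fun k => by linarith [(hn k).1]
  have hu1 : ∀ k, ‖u k‖ = 1 := fun k => by
    rw [hu, norm_smul, norm_inv, norm_norm, inv_mul_cancel₀ (hr k).ne']
  have hX1 : ∀ y ∈ X, ‖y‖ = 1 := by
    intro y hy
    obtain ⟨k, -, rfl⟩ := Finset.mem_image.1 hy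
    exact hu1 k
  have htu : ∀ k, t k = ‖t k‖ • u k := fun k => by
    rw [hu, smul_smul, mul_inv_cancel₀ (hr k).ne', one_smul]
  have huinj : Function.Injective u := by
    intro k l hkl
    by_contra hne
    have h1 := (hd k l hne).1
    rw [dist_eq_norm, htu k, htu l, hkl, ← sub_smul, norm_smul, hu1, mul_one,
      Real.norm_eq_abs] at h1
    have h2 : |‖t k‖ - ‖t l‖| ≤ 1 / 25 :=
      abs_sub_le_iff.2 ⟨by linarith [(hn k).2, (hn l).1], by linarith [(hn l).2, (hn k).1]⟩
    linarith
  have h0 : (0 : E3) ∈ interior (convexHull ℝ (X : Set E3)) := by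
    have hXu : (X : Set E3) = Set.range u := by
      rw [Finset.coe_image, Finset.coe_univ, Set.image_univ]
    rw [hXu]
    exact stub_originInterior t hinj hn hd h4
  have hmem : ∀ {S : Finset (Fin 12)}, S ∈ tri → S.image u ∈ fanTriSets X := fun hS =>
    (Finset.mem_filter.1 hS).2
  have hcard : ∀ {S : Finset (Fin 12)}, S ∈ tri → S.card = 3 := fun hS => by
    rw [← Finset.card_image_of_injective _ huinj]
    exact card_eq_three_of_mem_fanTriSets hX1 (hmem hS)
  refine ⟨fun S v => triAngleAt_nonneg _ _ _,
    fun S v hv => triAngleAt_eq_zero_of_not_mem (mt huinj.mem_finset_image.1 hv),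
    fun v => sum_triAngleAt_labels hX1 huinj h0 v, ?_, ?_, ?_⟩
  · -- T-corner: a bonded triangle
    intro S hS hb v hv
    have hT := hmem hS
    obtain ⟨a, b, hva, hvb, hab, rfl⟩ := exists_eq_triple (hcard hS) hv
    have ha : a ∈ ({v, a, b} : Finset (Fin 12)) := by simp
    have hb' : b ∈ ({v, a, b} : Finset (Fin 12)) := by simp
    refine (triAngleAt_labels_eq hu hr hX1 huinj hT hva hvb).trans_le ?_
    exact stub_tCornerMax (t v) (t a) (t b) (hn v) (hn a) (hn b)
      ⟨(hd v a hva).1, hb v hv a ha hva⟩ ⟨(hd v b hvb).1, hb v hv b hb' hvb⟩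
      ⟨(hd a b hab).1, hb a ha b hb' hab⟩
  · -- H-corner: `{v, a, x}` with bonds `va`, `ax` and `vx` far
    intro v a x hS hva hax hvx
    have hT := hmem hS
    obtain ⟨hva', hvx'⟩ := ne_of_card_triple (hcard hS)
    have hax' : a ≠ x := fun h => by rw [h] at hva; linarith
    refine (triAngleAt_labels_eq hu hr hX1 huinj hT hva' hvx').trans_le ?_
    exact stub_hCornerMax (t v) (t a) (t x) (hn v) (hn a) (hn x) ⟨(hd v a hva').1, hva⟩
      ⟨(hd a x hax').1, hax⟩ hvx
  · -- Q-corner: `{v, d, a}` with the quad `v d x a` split by its other diagonal `vx`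
    intro v d a x hS hvd hva _hda hdx hxa hvx
    have hT := hmem hS
    obtain ⟨hvd', hva'⟩ := ne_of_card_triple (hcard hS)
    have hdx' : d ≠ x := fun h => by rw [h] at hvd; linarith
    have hax' : a ≠ x := fun h => by rw [h] at hva; linarith
    refine (triAngleAt_labels_eq hu hr hX1 huinj hT hvd' hva').trans_le ?_
    calc angle (perpTo (t v) (t d)) (perpTo (t v) (t a))
        ≤ angle (perpTo (t v) (t d)) (perpTo (t v) (t x)) +
            angle (perpTo (t v) (t x)) (perpTo (t v) (t a)) := angle_le_angle_add_angle _ _ _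
      _ ≤ Real.arccos (807 / 2000) + Real.arccos (807 / 2000) := by
          refine add_le_add (stub_hCornerMax (t v) (t d) (t x) (hn v) (hn d) (hn x)
            ⟨(hd v d hvd').1, hvd⟩ ⟨(hd d x hdx').1, hdx⟩ hvx) ?_
          rw [angle_comm]
          exact stub_hCornerMax (t v) (t a) (t x) (hn v) (hn a) (hn x) ⟨(hd v a hva').1, hva⟩
            ⟨(hd a x hax').1, by rw [dist_comm]; exact hxa⟩ hvx
      _ = 2 * Real.arccos (807 / 2000) := (two_mul _).symm


/-- **`stub_fanAngles`, registered form** (skeleton v6 of line `Sketch`): the abbreviations `u`, `X`, `tri`, `ang`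
are explicit arguments with their defining equations (a `let` in a registered signature is cut at its
`:=` by the stub registry); immediate from the `let` form `stub_fanAngles_let` above. -/
theorem stub_fanAngles (t : Fin 12 → EuclideanSpace ℝ (Fin 3)) (hinj : Function.Injective t)
    (hn : ∀ k, 1 - 1 / 50 ≤ ‖t k‖ ∧ ‖t k‖ ≤ 1 + 1 / 50)
    (hd : ∀ k l, k ≠ l → 1 - 1 / 50 ≤ dist (t k) (t l) ∧ (dist (t k) (t l) ≤ 1 + 1 / 50 ∨ 63 / 50 ≤ dist (t k) (t l)))
    (h4 : ∀ k, (Finset.univ.filter fun l => l ≠ k ∧ dist (t k) (t l) ≤ 1 + 1 / 50).card = 4)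
    (u : Fin 12 → EuclideanSpace ℝ (Fin 3)) (hu : u = fun k => ‖t k‖⁻¹ • t k)
    (X : Finset (EuclideanSpace ℝ (Fin 3))) (hX : X = Finset.univ.image u)
    (tri : Finset (Finset (Fin 12)))
    (htri : tri = Finset.univ.powerset.filter fun S => S.image u ∈ fanTriSets X)
    (ang : Finset (Fin 12) → Fin 12 → ℝ) (hang : ang = fun S k => triAngleAt X (S.image u) (u k)) :
    (∀ S v, 0 ≤ ang S v) ∧ (∀ S v, v ∉ S → ang S v = 0) ∧ (∀ v, ∑ S ∈ tri, ang S v = 2 * Real.pi) ∧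
      (∀ S ∈ tri, (∀ v ∈ S, ∀ w ∈ S, v ≠ w → dist (t v) (t w) ≤ 1 + 1 / 50) → ∀ v ∈ S, ang S v ≤ Real.arccos (1 / 4)) ∧
      (∀ v a x, ({v, a, x} : Finset (Fin 12)) ∈ tri → dist (t v) (t a) ≤ 1 + 1 / 50 → dist (t a) (t x) ≤ 1 + 1 / 50 →
        63 / 50 ≤ dist (t v) (t x) → ang {v, a, x} v ≤ Real.arccos (807 / 2000)) ∧
      (∀ v d a x, ({v, d, a} : Finset (Fin 12)) ∈ tri → dist (t v) (t d) ≤ 1 + 1 / 50 → dist (t v) (t a) ≤ 1 + 1 / 50 →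
        63 / 50 ≤ dist (t d) (t a) → dist (t d) (t x) ≤ 1 + 1 / 50 → dist (t x) (t a) ≤ 1 + 1 / 50 →
        63 / 50 ≤ dist (t v) (t x) → ang {v, d, a} v ≤ 2 * Real.arccos (807 / 2000)) := by
  subst hang htri hX hu
  exact stub_fanAngles_let t hinj hn hd h4

end Summit.AtomisticToContinuum.Crystallization.Theorems
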